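import Literature.AlgebraicGeometry.HodgeTheory.GenericallyFramedChernClasses
import Summits.HodgeConjecture.HodgeConjecture.Theorems.GenericDivisibilityHodgeClassesGenericallyDivisibleDivisorIdeal

/-!
# Route GenericDivisibility — crux `HodgeClassesGenericallyDivisible` (C1, item stmt-HodgeConjecture-18466):
# the CHERN-IDEAL sector, unconditionally, in every dimension `2p`

After the surface case `p = 1` (`…Integral`, integral Lefschetz `(1,1)`) and the divisor-ideal
sector (`…DivisorIdeal`: the ideal of `H^*(X(ℂ); ℤ)` generated by the integral `(1,1)`-classes
`= c₁` of line bundles), this file records the next unconditional sector of the crux C1, the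
**Chern ideal**: the two-sided ideal of `H^*(X(ℂ); ℤ)` generated by the positive-degree integral
Chern classes `cᵢ(E)` (Husemoller Ch. 17; the tree's proved theory `chernClassZ`) of the complex
vector bundles `E` on `X(ℂ)` that are FRAMED over the complex points of a non-empty Zariski open —
every algebraic vector bundle, read on `X(ℂ)`, is of this kind (it is free on a non-empty affine
open and an algebraic frame is a continuous frame; the GAGA form is
`chernClassZ_analytification_mem_coniveauFiltration_one_of_isFinLocallyFreeOn` of
`HodgeTheory/GenericallyFramedChernClasses`). By naturality (C₁) and the vanishing of the positive
Chern classes of a framed bundle, `cᵢ(E)` restricts to ZERO on that open INTEGRALLY — no torsion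
residue, so no appeal to `TorsionDiesGenerically` — and the coniveau-`1` integral classes form a cup
ideal; hence C1 holds, with `y = 0`, for every middle class in the Chern ideal, on every smooth
projective `2p`-fold and for every `m ≥ 1`:

* `hodgeClassesGenericallyDivisible_of_mem_span_cupProduct_chernClassZ` — **the Chern-ideal
  sector of C1**: `z` in the `ℤ`-span of the `cᵢ(E) ⌣ w`, `w ⌣ cᵢ(E)` (`i ≥ 1`, `E` generically
  framed, `w` arbitrary) ⇒ the conclusion of C1 for `z` at every `m`;
* `stub_hodgeClassesGenericallyDivisible_chernIdeal` — the registered sub-goal of the item of that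
  name (the item's statement with "`z` in the Chern ideal" in place of "`z ⊗ ℂ` of type `(p,p)`",
  which Chern classes of algebraic bundles satisfy but which is not used).

The sector is strictly larger than the divisor ideal (`c₂` of a rank-two bundle is in general not in
the ideal of divisor classes: `σ₁₁ = c₂(S)` on the quadric fourfold `G(2,4)`), and rationally the
Chern subring of the algebraic bundles is the whole ring of algebraic classes
(`ch : K₀ ⊗ ℚ ≅ CH^* ⊗ ℚ`); integrally it contains `(p-1)! · cl(W)` for every codimension-`p`
subvariety. The crux itself (all `(p,p)`-classes, `p ≥ 2`) is untouched: it is of Hodge-conjecture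
strength (`Theorems/GenericDivisibilityHodgeClassesGenericallyDivisible`).

References: D. Husemoller, *Fibre Bundles* (1994), Ch. 17 §3 (C₁), Prop. 3.3, Prop. 4.1
[HusemollerFibreBundles1994]; J. Milnor, J. Stasheff, *Characteristic Classes* (1974), §2 Thm. 2.2
[MilnorStasheff1974]; S. Bloch, A. Ogus, Ann. Sci. ÉNS 7 (1974), (3.8) [BlochOgus1974ENS];
A. Hatcher, *Algebraic Topology* (2002), Prop. 3.10 [HatcherAT2002].
-/

-- `Summit.HodgeConjecture.HodgeConjecture.Theorems` is the mandated namespace (single-problem summit: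
-- Problem = Summit), which `linter.dupNamespace` flags on every declaration; the lakefile turns the
-- linter off tree-wide (weak option), restated here so stand-alone elaboration is warning-free too.
set_option linter.dupNamespace false

noncomputable section

namespace Summit.HodgeConjecture.HodgeConjecture.Theorems

open Literature.AlgebraicGeometry.Motives Literature.AlgebraicGeometry.HodgeTheory
  Literature.AlgebraicTopology.SingularHomology
open Summit.HodgeConjecture.HodgeConjecture.Theses.GenericDivisibility

/-- **The Chern-ideal sector of C1, unconditionally.** For `X` a smooth projective complex
`2p`-fold and `z ∈ H²ᵖ(X(ℂ); ℤ)` in the `ℤ`-span of the cup products `cᵢ(E) ⌣ w`, `w ⌣ cᵢ(E)`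
(`i ≥ 1`, `E` a complex vector bundle on `X(ℂ)` framed over the complex points of a non-empty
Zariski open, `w` arbitrary) and every `m`, there are a proper Zariski-closed `Z` and `y` (namely
`0`) on `(X ∖ Z)(ℂ)` with `m • y = z|_{(X ∖ Z)(ℂ)}`: the Chern ideal lies in `N¹ H^*(X(ℂ); ℤ)`
(`span_cupProduct_chernClassZ_le_coniveauFiltration_one`: naturality (C₁) of the Chern classes and
their vanishing on framed bundles). [cite: HusemollerFibreBundles1994, Ch. 17 §3 (C₁) and Prop. 4.1]
[cite: MilnorStasheff1974, §2 Thm. 2.2] [cite: HatcherAT2002, Prop. 3.10] -/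
theorem hodgeClassesGenericallyDivisible_of_mem_span_cupProduct_chernClassZ
    ⦃p : ℕ⦄ ⦃X : SchemeOver ℂ⦄ (hX : IsSmoothProjective (2 * p) X)
    (z : singularCohomology ℤ ℤ (ComplexPoints X) (2 * p))
    (hz : z ∈ Submodule.span ℤ {x : singularCohomology ℤ ℤ (ComplexPoints X) (2 * p) |
        ∃ (i r q : ℕ)
          (E : Literature.AlgebraicTopology.CharacteristicClasses.ComplexVectorBundle.{0, 0}
            (ComplexPoints X))
          (Z : Set X.left) (σ : Fin r → (P : complexPointsCompl X Z) → E.E P.1)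
          (w : singularCohomology ℤ ℤ (ComplexPoints X) q),
          0 < i ∧ IsClosed Z ∧ Z ≠ Set.univ ∧
          (∀ j, Continuous fun P : complexPointsCompl X Z ↦ (⟨P.1, σ j P⟩ : Bundle.TotalSpace E.F E.E)) ∧
          (∀ P : complexPointsCompl X Z, LinearIndependent ℂ (fun j ↦ σ j P) ∧
            ⊤ ≤ Submodule.span ℂ (Set.range fun j ↦ σ j P)) ∧
          ((∃ h : 2 * i + q = 2 * p, x = cupProduct h
              (Literature.AlgebraicTopology.CharacteristicClasses.chernClassZ E i) w) ∨
            (∃ h : q + 2 * i = 2 * p, x = cupProduct h w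
              (Literature.AlgebraicTopology.CharacteristicClasses.chernClassZ E i)))}) (m : ℕ) :
    ∃ Z : Set X.left, IsClosed Z ∧ Z ≠ Set.univ ∧
      ∃ y : singularCohomology ℤ ℤ (complexPointsCompl X Z) (2 * p),
        m • y = singularCohomology.map ℤ ℤ
          (⟨Subtype.val, continuous_subtype_val⟩ : C(complexPointsCompl X Z, ComplexPoints X))
          (2 * p) z :=
  hodgeClassesGenericallyDivisible_of_mem_coniveauFiltration_int hX z
    (span_cupProduct_chernClassZ_le_coniveauFiltration_one hX (2 * p) hz) m

/-- **Registered sub-goal `stub_hodgeClassesGenericallyDivisible_chernIdeal` of the crux item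
stmt-HodgeConjecture-18466** — its Chern-ideal sector with NO further hypothesis: the item's
statement with "`z` in the `ℤ`-span of the `cᵢ(E) ⌣ w`, `w ⌣ cᵢ(E)`, `i ≥ 1`, `E` framed over the
complex points of a non-empty Zariski open" in place of "`z ⊗ ℂ` of Hodge type `(p,p)`"; the proof
is `hodgeClassesGenericallyDivisible_of_mem_span_cupProduct_chernClassZ` (naturality (C₁) + framed
bundles have vanishing positive Chern classes + naturality of the cup product).
[cite: HusemollerFibreBundles1994, Ch. 17 §3 (C₁) and Prop. 4.1] [cite: MilnorStasheff1974, §2 Thm. 2.2]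
[cite: HatcherAT2002, Prop. 3.10] -/
theorem stub_hodgeClassesGenericallyDivisible_chernIdeal :
    ∀ ⦃p : ℕ⦄ ⦃X : SchemeOver ℂ⦄, 1 ≤ p → IsSmoothProjective (2 * p) X →
      ∀ z : singularCohomology ℤ ℤ (ComplexPoints X) (2 * p),
        z ∈ Submodule.span ℤ {x : singularCohomology ℤ ℤ (ComplexPoints X) (2 * p) |
          ∃ (i r q : ℕ)
            (E : Literature.AlgebraicTopology.CharacteristicClasses.ComplexVectorBundle.{0, 0}
              (ComplexPoints X))
            (Z : Set X.left) (σ : Fin r → (P : complexPointsCompl X Z) → E.E P.1)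
            (w : singularCohomology ℤ ℤ (ComplexPoints X) q),
            0 < i ∧ IsClosed Z ∧ Z ≠ Set.univ ∧
            (∀ j, Continuous fun P : complexPointsCompl X Z ↦
              (⟨P.1, σ j P⟩ : Bundle.TotalSpace E.F E.E)) ∧
            (∀ P : complexPointsCompl X Z, LinearIndependent ℂ (fun j ↦ σ j P) ∧
              ⊤ ≤ Submodule.span ℂ (Set.range fun j ↦ σ j P)) ∧
            ((∃ h : 2 * i + q = 2 * p, x = cupProduct h
                (Literature.AlgebraicTopology.CharacteristicClasses.chernClassZ E i) w) ∨
              (∃ h : q + 2 * i = 2 * p, x = cupProduct h w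
                (Literature.AlgebraicTopology.CharacteristicClasses.chernClassZ E i)))} →
        ∀ m : ℕ, 1 ≤ m → ∃ Z : Set X.left, IsClosed Z ∧ Z ≠ Set.univ ∧
          ∃ y : singularCohomology ℤ ℤ (complexPointsCompl X Z) (2 * p),
            m • y = singularCohomology.map ℤ ℤ
              (⟨Subtype.val, continuous_subtype_val⟩ : C(complexPointsCompl X Z, ComplexPoints X))
              (2 * p) z :=
  fun _ _ _ hX z hz m _ ↦ hodgeClassesGenericallyDivisible_of_mem_span_cupProduct_chernClassZ hX z hz m

end Summit.HodgeConjecture.HodgeConjecture.Theorems
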